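import Literature.MathematicalPhysics.QuantumFieldTheory.Balaban1983to89.B9Eq3126H1BlockDecay
import Literature.MathematicalPhysics.QuantumFieldTheory.Balaban1983to89.B9Eq3126ClosingRadiusWindow

/-!
# `Balaban1983to89.B9Eq3126H1BlockDecayUniformRadius` — T. Bałaban, *Propagators for lattice gauge theories in a background field*, Commun. Math. Phys. **99**
# (1985) 389–434 [Balaban1985BackgroundPropagators] (3.26) p. 395, (3.49) p. 399 («`|H(x, y)| ≤ O(1)e^{−δ₀d(x,y)}` … the constants … independent of the field
# configuration»), (3.126) p. 420, Thm 3.11 p. 416 with [Balaban1985Variational] (45) p. 285, (103) p. 293: **THE `H₁` ROW OF ROAD ΔA-CT IN `∃`-FIRST FORM — ONE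
# RATE `r₀ > 0`, A FUNCTION OF THE U-INDEPENDENT LETTERS ONLY, BEFORE EVERY BACKGROUND**: given `γ, μ₁, p_K < γ∕2, a, C_Q, κ₁, s_A`, the slopes `N_β, N_K` of the
# conjugation letters in the radius, the windows' `ℓ, ℓ′, η` and the fibre readings `M_φ, M_φ′`: `∃ r₀ > 0` such that for EVERY background `U` (unit-ball,
# mutually adjoint transports), every onto `Q` with `‖Q‖ ≤ C_Q`, every `Δ_a(U)` `γ`-coercive with `Δ′` floor `p_K` and `QG₁Q† ≥ μ₁`, every `C_P ≤ √(C_Q∕√κ₁)`, whose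
# conjugated `Q` ∕ `Δ′` ∕ `R(U)` letters hold LINEARLY IN THE RADIUS (`β = N_βr`, `β_K = N_Kr`, `ρ = 15(N_βr)s_A∕√κ₁` for `r ≤ r₀`) and whose `Q†` has block-to-point
# decay `C_Q†` at rate `r₀`: `‖P_{y₁} ∘ H₁(U) ∘ r_{y₀}‖ ≤ (4∕γ)e^{r₀}·C_Q†·(2∕μ₁)e^{r₀}·K_d(r₀∕2)²·e^{−(r₀∕2)·d_m(y₀,y₁)}` — `B9Eq3126H1BlockDecay.norm_block_H1ofU_le` at the
# radius of `B9Eq3126ClosingRadiusWindow.exists_radius_closing` (capped by the radius window `rℓη ≤ 1` and a consumer's cap `R`, with `r₀ ≤ R`, `N_βr₀ ≤ 1`,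
# `r₀ℓη ≤ 1` EXPOSED in the `∃` clause so that the `r`-linear letters and the `Q†` decay are dischargeable on `[0, r₀]`), rate loss `r₀ → r₀∕2`

statement-level skeleton of published theorems with citation tags; proofs where landed; nothing here is a claim about the Yang–Mills mass gap

CITATION HEADER (lean-in-tree rule).  Audit cell `pub-balaban`, sub-cell `t4`, BINDER row NE9 (road ΔA-CT of the NE9 formalisation swarm, leaf prover 03
`b2b-balaban-t4-ne9-formalise-leaf-03` gen 76).  Imports this lineage's (H1D) `B9Eq3126H1BlockDecay` and (CRW) `B9Eq3126ClosingRadiusWindow`.  Sources READ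
first-hand: [Balaban1985BackgroundPropagators] p. 399 (3.49) (print's `δ₀` and `O(1)` are NOT asserted: `r₀` and the constant are the cell's window sizes in the
displayed letters), p. 395 (3.26), p. 416 Thm 3.11, p. 420 (3.126); [Balaban1985Variational] p. 285 (45), p. 293 (103).

WHAT IS PROVED (sorry-free; proof lane — no `def`; [folklore] composition BY NAME).
* **`exists_rate_block_decay_H1ofU`** — `∃ r₀`, `r₀ = min r₀^{CRW} (min (1∕(ℓη)) R)` EXPOSED (the closed-form radius of `B9Eq3126ClosingRadiusWindow.radius0_pos`, so a
  valuing consumer can bound `K_d(r₀∕2)²` by letters — t4-ne9-idea-1 g149 L-g149-1), `0 < r₀ ≤ R`, `N_βr₀ ≤ 1`, `r₀ℓη ≤ 1`, then `∀ U, Q, …` as displayed: the END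
  of the `H₁` row at rate `r₀∕2`.
HONEST SCOPE.  The quantifier order is the content: `r₀` depends on `γ, μ₁, p_K, a, C_Q, κ₁, s_A, N_β, N_K, ℓ, η` ONLY; every analytic letter stays DISPLAYED inside
the `∀` (coercivity = Thm 3.11, `μ₁` = [B11] (45), `p_K`, the `r`-linear conjugation letters — suppliers: the OWNER's `B9Eq349ConjugatedQLetters` ∕
`B9Eq369CurvFormConjugation`, this lineage's PDC ∕ PDQ, (HQA) for `C_Q†`, (MU1) for `μ₁`); no number; NOT NE9 (cell pub-balaban: NE9 NOT PRINTED ∕ NOT PROVED; «NE9 ⇐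
the named binders»; row WALLED ON A MODEL (O-NE9-1; #5 UNRULED); spine PROVED 0∕9; rung (B)+1 on a finite T⁴ — NOT infinite volume, NOT mass gap, NOT BetaPertH, NOT
Clay; HONEST DEPENDENCY: continuum YM on T⁴ ⇐ BetaPertH ∧ nine spine estimates (0/9 proved); BetaPertH ⇐ (D1) ∧ (D4) ∧ CAP+tail).  NEW file; nothing modified.
Net new unproved facts: 0.
-/

noncomputable section

open scoped InnerProductSpace ComplexConjugate
open NormedSpace

namespace Literature.MathematicalPhysics.QuantumFieldTheory.Balaban1983to89.B9Eq3126H1BlockDecayUniformRadius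

open B4Sect5Torus (TSite tdist)
open B4Sect5Proof (latticeConst)
open B9SectCLatticeCarrier (Bond bpos btgt)
open B9Eq311L2Pairing (WL2)
open B9Eq319QprimeTorus (fineP blockCoord)
open B7Prop1Explicit (U1)
open B11Eq103H1Complex (SiteL2K BondL2K covDivL2K KinvLatticeK)
open B9Eq310HessianOperator (adTransportW PlaqL2K curvOp)
open B9Eq326OperatorAssembly (laplaceAofU RofU G1ofU H1ofU)
open B9Eq3126H1BlockDecay (norm_block_H1ofU_le)
open B9Eq3126ClosingRadiusWindow (radius0_pos closing_of_r_le_radius0)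

variable {d : ℕ} {L : ℕ} [NeZero L] {m : Fin d → ℕ} {𝔸 : Type*} [NormedRing 𝔸] [StarRing 𝔸] [NormedAlgebra ℂ 𝔸] [StarModule ℂ 𝔸] [NormOneClass 𝔸]
  {W : Type*} [NormedAddCommGroup W] [InnerProductSpace ℂ W] [FiniteDimensional ℂ W] (φ : W ≃ₗ[ℂ] 𝔸) {Mφ Mφ' : ℝ}
  (hφ : ∀ w, ‖φ w‖ ≤ Mφ * ‖w‖) (hφ' : ∀ X, ‖φ.symm X‖ ≤ Mφ' * ‖X‖) (hMφ : 0 ≤ Mφ) (hMφ' : 0 ≤ Mφ')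
  {c₀ c₁ : ℝ} [Fact (0 < c₀)] [Fact (0 < c₁)] {η : ℝ} (hη : 0 < η) (hηL : η * L = 1) (τ : 𝔸 →ₗ[ℂ] ℂ) (a : ℝ)

include hφ hφ' hMφ hMφ' hη hηL in
/-- **THE `H₁` ROW, `∃ r₀ > 0` BEFORE `∀ U`**: see the module header. The radius is `r₀ = min (r₀^{CRW}) (min (1∕(ℓη)) R)` for a CAP `R > 0` chosen by the
consumer (the smallest radius window of its letter suppliers), and the `∃` clause EXPOSES `r₀ ≤ R`, `N_βr₀ ≤ 1`, `r₀ℓη ≤ 1` so that the `r`-dependent hypotheses are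
dischargeable on `[0, r₀]` (the located asks of ne9-leaf-02 g79 A-leaf02-g79-1 and t4-ne9-idea-1 g148 L-g148-7); inside the `∀`, the letters of
`B9Eq3126H1BlockDecay.norm_block_H1ofU_le` with `β := N_βr₀`, `β_K := N_Kr₀`, `ρ := 15(N_βr₀)s_A∕√κ₁`, the conjugation letters asked for every `r ∈ [0, r₀]` (used at `r₀`),
the radius windows as the slope conditions `4ℓM_φM_φ′d√d ≤ N_β`, `4ℓM_φM_φ′d ≤ N_β`, `2ℓM_φM_φ′√d ≤ N_β`.
[cite: Balaban1985BackgroundPropagators, (3.26) p.395, (3.49) p.399, (3.126) p.420, Thm 3.11 p.416; Balaban1985Variational, (45) p.285, (103) p.293] -/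
theorem exists_rate_block_decay_H1ofU (ha : 0 ≤ a) (hm : ∀ i, 1 ≤ m i) (hL : 1 ≤ L)
    {γ pK CQ κ₁ sA μ₁ Nβ NK ℓ ℓ' CQa : ℝ} (hγ : 0 < γ) (hγ1 : γ ≤ 1) (hCQ : 0 ≤ CQ) (hκ₁ : 0 < κ₁) (hsA : 0 < sA) (hμ₁ : 0 < μ₁)
    (hNβ : 0 < Nβ) (hNK : 0 ≤ NK) (hgap : pK < γ / 2) (hℓ : 1 ≤ ℓ) (hℓ' : 1 ≤ ℓ') (hCQa : 0 ≤ CQa)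
    (hNβCC : 4 * ℓ * (Mφ * Mφ') * (d * Real.sqrt d) ≤ Nβ) (hNβC : 4 * ℓ * (Mφ * Mφ') * d ≤ Nβ) (hNβD : 2 * ℓ * (Mφ * Mφ') * Real.sqrt d ≤ Nβ)
    {R : ℝ} (hR : 0 < R) :
    ∃ r₀ : ℝ, r₀ = min (min (1 / Nβ) (min (Real.sqrt κ₁ / (120 * sA * Nβ))
      (min ((γ / 4 - pK / 2) / (Nβ * (4 * Real.sqrt (CQ / Real.sqrt κ₁) + 30 * sA * CQ / κ₁ + (21 + 3 * a)) + NK))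
        ((μ₁ / 2) / (Nβ * (4 / γ * (2 * CQ + 1) + CQ * (CQ + 1) *
          (4 / γ * (2 * (8 / γ) + (8 / γ + 4 / γ) + 2 * ((8 / γ + 4 / γ * Real.sqrt (CQ / Real.sqrt κ₁)) + 4 / γ) + a * CQ * (4 / γ) + a * (CQ + 1) * (4 / γ)) +
            15 * sA * ((8 / γ + 4 / γ * Real.sqrt (CQ / Real.sqrt κ₁)) * ((8 / γ + 4 / γ * Real.sqrt (CQ / Real.sqrt κ₁)) + 4 / γ)) / Real.sqrt κ₁)) +
          NK * (CQ * (CQ + 1) * (4 / γ) ^ 2)))))) (min (1 / (ℓ * η)) R) ∧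
      0 < r₀ ∧ r₀ ≤ R ∧ Nβ * r₀ ≤ 1 ∧ r₀ * ℓ * η ≤ 1 ∧
      ∀ (U : Bond d (fineP L m) → 𝔸ˣ) (_hU : ∀ b, U b ∈ U1 𝔸)
        (_hRS : ∀ (b : Bond d (fineP L m)) (v u : W), ⟪adTransportW φ U b v, u⟫_ℂ = ⟪v, adTransportW φ (fun b => (U b)⁻¹) b u⟫_ℂ)
        (Q : BondL2K ℂ d (fineP L m) c₀ W →ₗ[ℂ] BondL2K ℂ d m c₁ W)
        (hpos : ∀ x : BondL2K ℂ d (fineP L m) c₀ W, x ≠ 0 → 0 < RCLike.re ⟪x, laplaceAofU L m φ η U τ Q a x⟫_ℂ) (hQs : Function.Surjective Q)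
        (_hcoer : ∀ f : BondL2K ℂ d (fineP L m) c₀ W, γ * ‖f‖ ^ 2 ≤ RCLike.re ⟪f, laplaceAofU L m φ η U τ Q a f⟫_ℂ)
        (_hX1 : ∀ g : BondL2K ℂ d m c₁ W, μ₁ * ‖g‖ ^ 2 ≤ RCLike.re ⟪g, Q (G1ofU L m φ η U τ hpos (LinearMap.adjoint Q g))⟫_ℂ)
        (_hKre : ∀ f : BondL2K ℂ d (fineP L m) c₀ W, -(pK * ‖f‖ ^ 2) ≤ RCLike.re ⟪f, curvOp φ τ η U f⟫_ℂ)
        (_hQ : ∀ f, ‖Q f‖ ≤ CQ * ‖f‖) (CP : ℝ) (_hCP : 0 ≤ CP) (_hCP2 : CP ^ 2 ≤ CQ / Real.sqrt κ₁)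
        (_hQK : ∀ r : ℝ, 0 ≤ r → r ≤ r₀ → ∀ (χ : TSite d (fineP L m) → ℝ) (χ' : TSite d m → ℝ),
          (∀ b : Bond d (fineP L m), |χ (bpos b) - χ (btgt b)| ≤ ℓ * η) →
          (∀ (y : TSite d m), ∀ x ∈ B9Eq319QprimeTorus.blockOf L m y, |χ' y - χ x| ≤ ℓ') →
          ∀ (MB : BondL2K ℂ d (fineP L m) c₀ W →L[ℂ] BondL2K ℂ d (fineP L m) c₀ W),
          (∀ (g : BondL2K ℂ d (fineP L m) c₀ W) (b : Bond d (fineP L m)),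
            WL2.equiv ℂ (fun _ : Bond d (fineP L m) => c₀) W (MB g) b = (χ (bpos b) : ℂ) • WL2.equiv ℂ (fun _ : Bond d (fineP L m) => c₀) W g b) →
          ∀ (MS : SiteL2K ℂ d (fineP L m) c₀ W →L[ℂ] SiteL2K ℂ d (fineP L m) c₀ W),
          (∀ (g : SiteL2K ℂ d (fineP L m) c₀ W) (x : TSite d (fineP L m)),
            WL2.equiv ℂ (fun _ : TSite d (fineP L m) => c₀) W (MS g) x = (χ x : ℂ) • WL2.equiv ℂ (fun _ : TSite d (fineP L m) => c₀) W g x) →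
          ∀ (MF : BondL2K ℂ d m c₁ W →L[ℂ] BondL2K ℂ d m c₁ W),
          (∀ (g : BondL2K ℂ d m c₁ W) (b' : Bond d m),
            WL2.equiv ℂ (fun _ : Bond d m => c₁) W (MF g) b' = (χ' (bpos b') : ℂ) • WL2.equiv ℂ (fun _ : Bond d m => c₁) W g b') →
          ∀ κ : ℂ, ‖κ‖ = r →
          (∀ f, ‖exp (κ • MF) (Q (exp (κ • (-MB)) f)) - Q f‖ ≤ (Nβ * r) * ‖f‖) ∧
          (∀ g, ‖exp (κ • MB) (LinearMap.adjoint Q (exp (κ • (-MF)) g)) - LinearMap.adjoint Q g‖ ≤ (Nβ * r) * ‖g‖) ∧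
          (∀ f, ‖exp (κ • MB) (curvOp φ τ η U (exp (κ • (-MB)) f)) - curvOp φ τ η U f‖ ≤ (NK * r) * ‖f‖) ∧
          (∀ s, ‖exp (κ • MS) (RofU L m φ η U (c₀ := c₀) (exp (κ • (-MS)) s)) - RofU L m φ η U (c₀ := c₀) s‖ ≤
            (15 * ((Nβ * r) * sA) / Real.sqrt κ₁) * ‖s‖))
        (_hP : ∀ f, ‖covDivL2K ℂ c₀ ((η : ℂ))⁻¹ (adTransportW φ fun b => (U b)⁻¹) f -
          RofU L m φ η U (c₀ := c₀) (covDivL2K ℂ c₀ ((η : ℂ))⁻¹ (adTransportW φ fun b => (U b)⁻¹) f)‖ ≤ CP * ‖f‖)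
        (PB : TSite d m → BondL2K ℂ d (fineP L m) c₀ W →L[ℂ] BondL2K ℂ d (fineP L m) c₀ W)
        (_hPB : ∀ (y : TSite d m) (f : BondL2K ℂ d (fineP L m) c₀ W) (b : Bond d (fineP L m)),
          WL2.equiv ℂ (fun _ : Bond d (fineP L m) => c₀) W (PB y f) b =
            if blockCoord L m (bpos b) = y then WL2.equiv ℂ (fun _ : Bond d (fineP L m) => c₀) W f b else 0)
        (rF : TSite d m → BondL2K ℂ d m c₁ W →L[ℂ] BondL2K ℂ d m c₁ W)
        (_hrF : ∀ (y : TSite d m) (g : BondL2K ℂ d m c₁ W) (b' : Bond d m),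
          WL2.equiv ℂ (fun _ : Bond d m => c₁) W (rF y g) b' = if bpos b' = y then WL2.equiv ℂ (fun _ : Bond d m => c₁) W g b' else 0)
        (_hQa : ∀ z z', ‖PB z' ∘L LinearMap.toContinuousLinearMap (LinearMap.adjoint Q) ∘L rF z‖ ≤ CQa * Real.exp (-(r₀ * tdist m z z')))
        (y₀ y₁ : TSite d m),
        ‖PB y₁ ∘L LinearMap.toContinuousLinearMap (H1ofU L m φ η U τ hpos hQs) ∘L rF y₀‖ ≤
          (4 / γ * Real.exp r₀) * CQa * (2 / μ₁ * Real.exp r₀) * latticeConst d (r₀ / 2) ^ 2 * Real.exp (-(r₀ / 2 * tdist m y₀ y₁)) := by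
  have hrc := radius0_pos (a := a) (pK := pK) (CQ := CQ) hγ ha hCQ hκ₁ hsA hμ₁ hNβ hNK hgap
  have hclose := fun (r CP : ℝ) (hr : 0 ≤ r) (hr0 : r ≤ min (1 / Nβ) (min (Real.sqrt κ₁ / (120 * sA * Nβ))
          (min ((γ / 4 - pK / 2) / (Nβ * (4 * Real.sqrt (CQ / Real.sqrt κ₁) + 30 * sA * CQ / κ₁ + (21 + 3 * a)) + NK))
            ((μ₁ / 2) / (Nβ * (4 / γ * (2 * CQ + 1) + CQ * (CQ + 1) *
              (4 / γ * (2 * (8 / γ) + (8 / γ + 4 / γ) + 2 * ((8 / γ + 4 / γ * Real.sqrt (CQ / Real.sqrt κ₁)) + 4 / γ) + a * CQ * (4 / γ) + a * (CQ + 1) * (4 / γ)) +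
                15 * sA * ((8 / γ + 4 / γ * Real.sqrt (CQ / Real.sqrt κ₁)) * ((8 / γ + 4 / γ * Real.sqrt (CQ / Real.sqrt κ₁)) + 4 / γ)) / Real.sqrt κ₁)) +
              NK * (CQ * (CQ + 1) * (4 / γ) ^ 2)))))) (hCP : 0 ≤ CP) (hCP2 : CP ^ 2 ≤ CQ / Real.sqrt κ₁) =>
    closing_of_r_le_radius0 (pK := pK) (μ₁ := μ₁) hγ ha hCQ hκ₁ hsA hNβ hNK hr hCP hCP2 hr0
  set rc : ℝ := min (1 / Nβ) (min (Real.sqrt κ₁ / (120 * sA * Nβ))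
          (min ((γ / 4 - pK / 2) / (Nβ * (4 * Real.sqrt (CQ / Real.sqrt κ₁) + 30 * sA * CQ / κ₁ + (21 + 3 * a)) + NK))
            ((μ₁ / 2) / (Nβ * (4 / γ * (2 * CQ + 1) + CQ * (CQ + 1) *
              (4 / γ * (2 * (8 / γ) + (8 / γ + 4 / γ) + 2 * ((8 / γ + 4 / γ * Real.sqrt (CQ / Real.sqrt κ₁)) + 4 / γ) + a * CQ * (4 / γ) + a * (CQ + 1) * (4 / γ)) +
                15 * sA * ((8 / γ + 4 / γ * Real.sqrt (CQ / Real.sqrt κ₁)) * ((8 / γ + 4 / γ * Real.sqrt (CQ / Real.sqrt κ₁)) + 4 / γ)) / Real.sqrt κ₁)) +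
              NK * (CQ * (CQ + 1) * (4 / γ) ^ 2))))) with hrc_def
  have hℓη : 0 < ℓ * η := mul_pos (by linarith only [hℓ]) hη
  have hw0 : 0 < 1 / (ℓ * η) := by positivity
  have hr₀pos : 0 < min rc (min (1 / (ℓ * η)) R) := lt_min hrc (lt_min hw0 hR)
  have hr₀0 : 0 ≤ min rc (min (1 / (ℓ * η)) R) := hr₀pos.le
  have hr₀c : min rc (min (1 / (ℓ * η)) R) ≤ rc := min_le_left _ _
  have hr₀w : min rc (min (1 / (ℓ * η)) R) ≤ 1 / (ℓ * η) := (min_le_right _ _).trans (min_le_left _ _)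
  have hr₀R : min rc (min (1 / (ℓ * η)) R) ≤ R := (min_le_right _ _).trans (min_le_right _ _)
  have hwin : min rc (min (1 / (ℓ * η)) R) * ℓ * η ≤ 1 := by
    have h := (le_div_iff₀ hℓη).mp hr₀w
    calc min rc (min (1 / (ℓ * η)) R) * ℓ * η = min rc (min (1 / (ℓ * η)) R) * (ℓ * η) := by ring
      _ ≤ 1 := h
  -- `N_β r₀ ≤ 1` is exposed: the closing at the admissible `C_P := 0`
  have hβ1' : Nβ * min rc (min (1 / (ℓ * η)) R) ≤ 1 :=
    (hclose _ 0 hr₀0 hr₀c le_rfl (by rw [zero_pow two_ne_zero]; positivity)).1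
  refine ⟨min rc (min (1 / (ℓ * η)) R), by rw [hrc_def], hr₀pos, hr₀R, hβ1', hwin, ?_⟩
  intro U hU hRS Q hpos hQs hcoer hX1 hKre hQ CP hCP hCP2 hQK hP PB hPB rF hrF hQa y₀ y₁
  obtain ⟨hβ1, hsmall, hρ8, -, hsmall2⟩ := hclose (min rc (min (1 / (ℓ * η)) R)) CP hr₀0 hr₀c hCP hCP2
  have hβ : 0 ≤ Nβ * min rc (min (1 / (ℓ * η)) R) := mul_nonneg hNβ.le hr₀0
  have hβCC : 4 * min rc (min (1 / (ℓ * η)) R) * ℓ * (Mφ * Mφ') * (d * Real.sqrt d) ≤ Nβ * min rc (min (1 / (ℓ * η)) R) :=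
    calc 4 * min rc (min (1 / (ℓ * η)) R) * ℓ * (Mφ * Mφ') * (d * Real.sqrt d) = min rc (min (1 / (ℓ * η)) R) * (4 * ℓ * (Mφ * Mφ') * (d * Real.sqrt d)) := by ring
      _ ≤ min rc (min (1 / (ℓ * η)) R) * Nβ := mul_le_mul_of_nonneg_left hNβCC hr₀0
      _ = Nβ * min rc (min (1 / (ℓ * η)) R) := by ring
  have hβC : 4 * min rc (min (1 / (ℓ * η)) R) * ℓ * (Mφ * Mφ') * d ≤ Nβ * min rc (min (1 / (ℓ * η)) R) :=
    calc 4 * min rc (min (1 / (ℓ * η)) R) * ℓ * (Mφ * Mφ') * d = min rc (min (1 / (ℓ * η)) R) * (4 * ℓ * (Mφ * Mφ') * d) := by ring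
      _ ≤ min rc (min (1 / (ℓ * η)) R) * Nβ := mul_le_mul_of_nonneg_left hNβC hr₀0
      _ = Nβ * min rc (min (1 / (ℓ * η)) R) := by ring
  have hβD : 2 * min rc (min (1 / (ℓ * η)) R) * ℓ * (Mφ * Mφ') * Real.sqrt d ≤ Nβ * min rc (min (1 / (ℓ * η)) R) :=
    calc 2 * min rc (min (1 / (ℓ * η)) R) * ℓ * (Mφ * Mφ') * Real.sqrt d = min rc (min (1 / (ℓ * η)) R) * (2 * ℓ * (Mφ * Mφ') * Real.sqrt d) := by ring
      _ ≤ min rc (min (1 / (ℓ * η)) R) * Nβ := mul_le_mul_of_nonneg_left hNβD hr₀0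
      _ = Nβ * min rc (min (1 / (ℓ * η)) R) := by ring
  have hβK : 0 ≤ NK * min rc (min (1 / (ℓ * η)) R) := mul_nonneg hNK hr₀0
  have hρ : 0 ≤ 15 * ((Nβ * min rc (min (1 / (ℓ * η)) R)) * sA) / Real.sqrt κ₁ := by positivity
  have hr' : (0 : ℝ) ≤ min rc (min (1 / (ℓ * η)) R) / 2 := by positivity
  have hr'r : min rc (min (1 / (ℓ * η)) R) / 2 < min rc (min (1 / (ℓ * η)) R) := by linarith only [hr₀pos]
  have h := norm_block_H1ofU_le φ hφ hφ' hMφ hMφ' hη hηL U hU hRS τ Q a ha hm hL hpos hQs hγ hγ1 hβ hβ1 hβK hℓ hℓ' hr₀0 hρ hρ8 hCP hCQ hμ₁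
    hcoer hX1 hKre hQ hwin hβCC hβC hβD (hQK _ hr₀0 le_rfl) hP hsmall hsmall2 PB hPB hrF hCQa hr' hr'r hQa y₀ y₁
  have e : min rc (min (1 / (ℓ * η)) R) - min rc (min (1 / (ℓ * η)) R) / 2 = min rc (min (1 / (ℓ * η)) R) / 2 := by ring
  rw [e] at h
  exact h

end Literature.MathematicalPhysics.QuantumFieldTheory.Balaban1983to89.B9Eq3126H1BlockDecayUniformRadius

end
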